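import Summits.ValiantsHypothesis.ValiantsHypothesis.Theorems.FifoMatchingNNLowDegreeCofactorHardCarveMatchings
import Summits.ValiantsHypothesis.ValiantsHypothesis.Theorems.ZeroOneTransfer.Negative.TopComponentFree
import Summits.ValiantsHypothesis.ValiantsHypothesis.Theorems.ZeroOneTransfer.Negative.KillRows
import Literature.Computability.AlgebraicComplexity.ValiantClassesProofs
import HarnessLib

/-!
# Route FifoMatching — crux `NNLowDegreeCofactorHard` (stmt-ValiantsHypothesis-22993), line
# `freed_vertices`: stub S2 `stub_carveInterval` (carving an interval)

Registered line `Cruxes/NNLowDegreeCofactorHard/Lines/freed_vertices.lean`, stub **S2**, verbatim: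

* `stub_carveInterval` — for every vertex set `R ⊆ [2n]` and every `q ∈ ℝ≥0[x_(i,j)]` with the
  support of `NN_n^R := NN_n[x_e := 1, e touching R]` there are `n'` with `n ≤ (|R|+1)(n'+2)` and
  `g` in the arc variables of `[2n']` with EXACTLY the support of `NN_{n'}` and `L₊(g) ≤ L₊(q)`.

Proof.  Block pigeonhole instead of the card's "longest run": with `m := n / (|R|+1)` the `|R|+1`
blocks `[2mk, 2mk+2m)`, `k ≤ |R|`, are disjoint, so one of them, `I`, misses `R`; its offset is
even and `n < (|R|+1)(m+1)`; take `n' := m` (if `m = 0`, `g := 1 = NN_0`).  Substitute (`Carve.Carving.subst`)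
`x_(i,j) ↦ x_(i-a,j-a)` for arcs inside `I`, `↦ 0` for arcs with exactly one endpoint in `I`,
`↦ 1` otherwise — a projection, free (`complexity_le_of_isProjection`) — and take the top-degree
component, free over `ℝ≥0` (`complexity_topComponent_le`).  Over `ℝ≥0` the supports of
`aeval φ q` and of a top component depend only on `supp q` (`support_aeval_congr`,
`support_topComponent_congr`), so one computes with `NN_n^R`: the image of the monomial of a
nest-free perfect matching `M` is `0` unless every arc of `M` leaving `I` ends in `R`, and then it
is `x^{M ∩ I×I}` of degree `≤ m`, with equality iff `M` maps `I` into `I`, in which case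
`M|_I` is a nest-free perfect matching of `I ≅ [2m]`; conversely every nest-free perfect matching
of `[2m]` extends by consecutive pairs (`Carve.Carving.extend`).  Hence the top component has
exactly the support of `NN_m`.

Honest framing: one registered stub (S2, the line's only new combinatorics) of one line; stubs
S1/S3, the crux `NNLowDegreeCofactorHard`, and `VP ≠ VNP` are NOT proved here; this is a rung of
the monotone division ladder (inside the `MonotoneGap` barrier by design).  No named facts.
-/

noncomputable section

-- Sub = Summit single-conjunct layout: the duplicated namespace component is mandated by the tree.
set_option linter.dupNamespace false

namespace Summit.ValiantsHypothesis.ValiantsHypothesis.Theorems.FifoMatching.NNLowDegreeCofactorHard.FreedVertices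

open Finset MvPolynomial Literature.Computability.AlgebraicComplexity
open Literature.Barriers.ValiantsHypothesis
open Summit.ValiantsHypothesis.ValiantsHypothesis.Theorems.ZeroOneTransfer.Negative
open scoped NNReal

namespace Carve

/-! ### Support calculus over `ℝ≥0` -/

section Support

variable {σ τ : Type*}

/-- Over `ℝ≥0` the support of a finite sum is the union of the supports. [folklore] -/
theorem support_finset_sum_eq [DecidableEq σ] {ι : Type*} (s : Finset ι)
    (f : ι → MvPolynomial σ ℝ≥0) :
    (∑ i ∈ s, f i).support = s.biUnion fun i => (f i).support := by
  classical
  induction s using Finset.cons_induction with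
  | empty => simp
  | cons a s ha ih =>
    rw [sum_cons, cons_eq_insert, biUnion_insert, JerrumSnir.support_add_eq, ih]

/-- Over `ℝ≥0` the support of `aeval f p` is the union, over the monomials `x^d` of `p`, of the
supports of `aeval f x^d`. [folklore] -/
theorem support_aeval_eq_biUnion [DecidableEq τ] (f : σ → MvPolynomial τ ℝ≥0)
    (p : MvPolynomial σ ℝ≥0) :
    (aeval f p).support = p.support.biUnion fun d => (aeval f (monomial d (1 : ℝ≥0))).support := by
  classical
  conv_lhs => rw [p.as_sum, map_sum]
  rw [support_finset_sum_eq]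
  refine Finset.biUnion_congr rfl fun d hd => ?_
  have h1 : monomial d (coeff d p) = coeff d p • monomial d (1 : ℝ≥0) := by
    rw [smul_monomial, smul_eq_mul, mul_one]
  rw [h1, map_smul, JerrumSnir.support_smul_eq (mem_support_iff.1 hd)]

/-- **Support-genericity of substitutions over `ℝ≥0`:** `supp (aeval f p)` depends only on
`supp p`. [folklore] -/
theorem support_aeval_congr (f : σ → MvPolynomial τ ℝ≥0) {p q : MvPolynomial σ ℝ≥0}
    (h : p.support = q.support) : (aeval f p).support = (aeval f q).support := by
  classical
  rw [support_aeval_eq_biUnion, support_aeval_eq_biUnion, h]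

/-- The support of the top `w`-component: the monomials of `p` of maximal weight. [folklore] -/
theorem support_topComponent_eq (w : σ → ℕ) (p : MvPolynomial σ ℝ≥0) :
    (topComponent w p).support =
      p.support.filter fun d => Finsupp.weight w d = p.support.sup (Finsupp.weight w) := by
  ext d
  rw [mem_filter, mem_support_iff, mem_support_iff, coeff_topComponent]
  by_cases h : Finsupp.weight w d = weightedTotalDegree w p
  · rw [if_pos h]
    exact ⟨fun hc => ⟨hc, h⟩, fun hc => hc.1⟩
  · rw [if_neg h]
    exact ⟨fun hc => absurd rfl hc, fun hc => absurd hc.2 h⟩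

/-- **Support-genericity of top components over `ℝ≥0`:** `supp (top_w p)` depends only on
`supp p`. [folklore] -/
theorem support_topComponent_congr (w : σ → ℕ) {p q : MvPolynomial σ ℝ≥0}
    (h : p.support = q.support) : (topComponent w p).support = (topComponent w q).support := by
  rw [support_topComponent_eq, support_topComponent_eq, h]

/-- The degree (weight `1`) of an arc set is its number of arcs. [folklore] -/
theorem weight_one_sum_single {ι : Type*} (s : Finset ι) (e : ι → τ) :
    Finsupp.weight (fun _ => 1) (∑ i ∈ s, Finsupp.single (e i) 1 : τ →₀ ℕ) = s.card := by
  rw [map_sum]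
  simp [Finsupp.weight_single]

end Support

/-! ### The carving substitution -/

namespace Carving

variable {n : ℕ} (C : Carving n)

/-- The carving substitution: an arc with both endpoints in `I` keeps its (renamed) variable, an
arc with exactly one endpoint in `I` is killed (`↦ 0`), any other arc is freed (`↦ 1`).
[folklore] -/
def subst (e : Fin (2 * n) × Fin (2 * n)) : MvPolynomial (Fin (2 * C.m) × Fin (2 * C.m)) ℝ≥0 :=
  if e.1 ∈ C.I ∧ e.2 ∈ C.I then X (C.dn e.1, C.dn e.2)
  else if e.1 ∈ C.I ∨ e.2 ∈ C.I then 0 else 1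

/-- The carving substitution is a projection (free for `complexity`). [folklore] -/
theorem isProjection_aeval_subst (p : MvPolynomial (Fin (2 * n) × Fin (2 * n)) ℝ≥0) :
    IsProjection (aeval C.subst p) p := by
  refine ⟨C.subst, fun e => ?_, rfl⟩
  unfold subst
  split_ifs
  · exact Or.inl ⟨_, rfl⟩
  · exact Or.inr ⟨0, C_0.symm⟩
  · exact Or.inr ⟨1, C_1.symm⟩

/-- The carving substitution after freeing the vertex set `R`. [folklore] -/
def substR (R : Finset (Fin (2 * n))) (e : Fin (2 * n) × Fin (2 * n)) :
    MvPolynomial (Fin (2 * C.m) × Fin (2 * C.m)) ℝ≥0 :=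
  if e.1 ∈ R ∨ e.2 ∈ R then 1 else C.subst e

/-- Carving `p^R = p[x_e := 1, e touching R]` is substituting `substR` into `p`. [folklore] -/
theorem aeval_subst_aeval_free (R : Finset (Fin (2 * n)))
    (p : MvPolynomial (Fin (2 * n) × Fin (2 * n)) ℝ≥0) :
    aeval C.subst (MvPolynomial.aeval (fun e : Fin (2 * n) × Fin (2 * n) =>
        if e.1 ∈ R ∨ e.2 ∈ R then (1 : MvPolynomial (Fin (2 * n) × Fin (2 * n)) ℝ≥0)
        else MvPolynomial.X e) p) = aeval (C.substR R) p := by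
  rw [comp_aeval_apply]
  have h : (fun i : Fin (2 * n) × Fin (2 * n) => aeval C.subst
      (if i.1 ∈ R ∨ i.2 ∈ R then (1 : MvPolynomial (Fin (2 * n) × Fin (2 * n)) ℝ≥0)
      else MvPolynomial.X i)) = C.substR R := by
    funext e
    unfold substR
    split_ifs <;> simp
  rw [h]

/-- The exponent of the image of the monomial of `M`: the internal arcs of `M`, renamed to
`[2m]`. [folklore] -/
def rexp (M : Fin (2 * n) → Fin (2 * n)) : (Fin (2 * C.m) × Fin (2 * C.m)) →₀ ℕ :=
  ∑ j ∈ C.intOp M, Finsupp.single (j, C.restrict M j) 1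

/-- The degree of `rexp M` is the number of internal arcs. [folklore] -/
theorem weight_rexp (M : Fin (2 * n) → Fin (2 * n)) :
    Finsupp.weight (fun _ => 1) (C.rexp M) = (C.intOp M).card :=
  weight_one_sum_single _ _

/-- If `M` maps `I` into `I`, `rexp M` is the arc set of the restriction `M|_I`. [folklore] -/
theorem rexp_eq_arcExponent {M : Fin (2 * n) → Fin (2 * n)} (hI : ∀ j, M (C.up j) ∈ C.I) :
    C.rexp M = arcExponent (C.restrict M) := by
  unfold rexp arcExponent
  refine sum_congr ?_ fun _ _ => rfl
  ext j
  rw [mem_intOp, mem_openers, C.lt_restrict_iff hI]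
  exact ⟨fun h => h.1, fun h => ⟨h, hI j⟩⟩

/-- **The image of one matching monomial.**  For a perfect matching `M` of `[2n]` (`I` disjoint
from `R`): `x^M ↦ x^{rexp M}` if every arc of `M` leaving `I` ends in `R`, and `↦ 0` otherwise.
[folklore] -/
theorem aeval_substR_arcMonomial {R : Finset (Fin (2 * n))} (hR : ∀ i ∈ C.I, i ∉ R)
    {M : Fin (2 * n) → Fin (2 * n)} (hM : M ∈ perfectMatchings (2 * n)) :
    aeval (C.substR R) (arcMonomial ℝ≥0 M) =
      if (∀ i, i ∉ C.I → M i ∈ C.I → i ∈ R) then monomial (C.rexp M) 1 else 0 := by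
  obtain ⟨hinv, hfp⟩ := mem_perfectMatchings.1 hM
  rw [arcMonomial_eq_prod_openers, map_prod]
  simp only [aeval_X]
  split_ifs with hgood
  · have key : ∀ i ∈ openers M, C.substR R (i, M i) =
        if (i ∈ C.I ∧ M i ∈ C.I) then X (C.dn i, C.dn (M i)) else 1 := by
      intro i _
      unfold substR subst
      dsimp only
      by_cases h1 : i ∈ C.I <;> by_cases h2 : M i ∈ C.I
      · have h3 : ¬(i ∈ R ∨ M i ∈ R) := not_or.2 ⟨hR i h1, hR _ h2⟩
        simp only [h3, h1, h2, and_self, if_true, if_false]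
      · have hMR : M i ∈ R := hgood (M i) h2 (by rw [hinv]; exact h1)
        simp only [hMR, or_true, if_true, h2, and_false, if_false]
      · have hiR : i ∈ R := hgood i h1 h2
        simp only [hiR, true_or, if_true, h1, false_and, if_false]
      · simp only [h1, h2, false_and, false_or, if_false, ite_self]
    rw [prod_congr rfl key, ← prod_filter]
    unfold rexp
    rw [monomial_sum_one]
    refine prod_nbij' C.dn C.up (fun i hi => ?_) (fun j hj => ?_) (fun i hi => ?_)
      (fun j _ => C.dn_up j) (fun i hi => ?_)
    · rw [mem_filter] at hi
      rw [mem_intOp, C.up_dn hi.2.1]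
      exact ⟨mem_openers.1 hi.1, hi.2.2⟩
    · rw [mem_intOp] at hj
      rw [mem_filter, mem_openers]
      exact ⟨hj.1, C.up_mem_I j, hj.2⟩
    · rw [mem_filter] at hi
      exact C.up_dn hi.2.1
    · rw [mem_filter] at hi
      show X (C.dn i, C.dn (M i)) =
        monomial (Finsupp.single (C.dn i, C.dn (M (C.up (C.dn i)))) 1) 1
      rw [C.up_dn hi.2.1]
      rfl
  · push Not at hgood
    obtain ⟨i, hiI, hMi, hiR⟩ := hgood
    have hMiR : M i ∉ R := hR _ hMi
    rcases lt_or_gt_of_ne (hfp i) with h | h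
    · apply prod_eq_zero (mem_openers.2 (show M i < M (M i) by rw [hinv]; exact h))
      unfold substR subst
      dsimp only
      simp only [hinv, hMiR, hiR, or_self, if_false, hiI, and_false, hMi, true_or, if_true]
    · apply prod_eq_zero (mem_openers.2 h)
      unfold substR subst
      dsimp only
      simp only [hiR, hMiR, or_self, if_false, hiI, false_and, hMi, or_true, if_true]

/-- **Carving `NN_n^R`:** the sum of `x^{rexp M}` over the nest-free perfect matchings `M` of
`[2n]` all of whose arcs leaving `I` end in `R`. [folklore] -/
theorem aeval_substR_nestFreeMatchingPoly {R : Finset (Fin (2 * n))} (hR : ∀ i ∈ C.I, i ∉ R) :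
    aeval (C.substR R) (nestFreeMatchingPoly n ℝ≥0) =
      ∑ M ∈ (nestFreeMatchings (2 * n)).filter (fun M => ∀ i, i ∉ C.I → M i ∈ C.I → i ∈ R),
        monomial (C.rexp M) (1 : ℝ≥0) := by
  rw [nestFreeMatchingPoly_eq_sum_arcMonomial, map_sum, sum_filter]
  exact sum_congr rfl fun M hM =>
    C.aeval_substR_arcMonomial hR (nestFreeMatchings_subset_perfectMatchings hM)

/-- The support of the carved `NN_n^R`. [folklore] -/
theorem support_aeval_substR {R : Finset (Fin (2 * n))} (hR : ∀ i ∈ C.I, i ∉ R) :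
    (aeval (C.substR R) (nestFreeMatchingPoly n ℝ≥0)).support =
      ((nestFreeMatchings (2 * n)).filter (fun M => ∀ i, i ∉ C.I → M i ∈ C.I → i ∈ R)).image
        C.rexp := by
  rw [C.aeval_substR_nestFreeMatchingPoly hR, support_sum_monomial_one]

/-- The maximal degree of the carved `NN_n^R` is `m` (attained by the consecutive-pairs
matching). [folklore] -/
theorem sup_weight_eq {R : Finset (Fin (2 * n))} :
    (((nestFreeMatchings (2 * n)).filter (fun M => ∀ i, i ∉ C.I → M i ∈ C.I → i ∈ R)).image
        C.rexp).sup (Finsupp.weight fun _ => 1) = C.m := by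
  apply le_antisymm
  · refine Finset.sup_le fun d hd => ?_
    obtain ⟨M, hM, rfl⟩ := mem_image.1 hd
    rw [weight_rexp]
    exact C.card_intOp_le (nestFreeMatchings_subset_perfectMatchings (mem_filter.1 hM).1)
  · have hN := partner_mem_nestFreeMatchings C.m
    have hI : ∀ j, C.extend (fun i => partner i) (C.up j) ∈ C.I := fun j => by
      rw [C.extend_up]; exact C.up_mem_I _
    have hmem : C.extend (fun i => partner i) ∈
        (nestFreeMatchings (2 * n)).filter (fun M => ∀ i, i ∉ C.I → M i ∈ C.I → i ∈ R) :=
      mem_filter.2 ⟨C.extend_mem_nestFreeMatchings hN,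
        fun i hi hMi => absurd ((C.extend_mem_I_iff _ i).1 hMi) hi⟩
    refine le_trans (le_of_eq ?_) (le_sup (mem_image_of_mem C.rexp hmem))
    rw [C.rexp_eq_arcExponent hI, C.restrict_extend, arcExponent, weight_one_sum_single,
      card_openers (nestFreeMatchings_subset_perfectMatchings hN)]

/-- **The top-degree monomials of the carved `NN_n^R` are exactly the arc sets of the nest-free
perfect matchings of `[2m]`.** [folklore] -/
theorem filter_weight_eq {R : Finset (Fin (2 * n))} :
    (((nestFreeMatchings (2 * n)).filter (fun M => ∀ i, i ∉ C.I → M i ∈ C.I → i ∈ R)).image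
        C.rexp).filter (fun d => Finsupp.weight (fun _ => 1) d = C.m) =
      (nestFreeMatchings (2 * C.m)).image arcExponent := by
  ext d
  simp only [mem_filter, mem_image]
  constructor
  · rintro ⟨⟨M, ⟨hMnf, -⟩, rfl⟩, hw⟩
    have hperf := nestFreeMatchings_subset_perfectMatchings hMnf
    rw [weight_rexp] at hw
    have hI := C.forall_mem_I_of_card_intOp hperf (by exact_mod_cast hw)
    exact ⟨C.restrict M, C.restrict_mem_nestFreeMatchings hMnf hI, (C.rexp_eq_arcExponent hI).symm⟩
  · rintro ⟨N, hN, rfl⟩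
    have hI : ∀ j, C.extend N (C.up j) ∈ C.I := fun j => by
      rw [C.extend_up]; exact C.up_mem_I _
    refine ⟨⟨C.extend N, ⟨C.extend_mem_nestFreeMatchings hN,
      fun i hi hMi => absurd ((C.extend_mem_I_iff N i).1 hMi) hi⟩, ?_⟩, ?_⟩
    · rw [C.rexp_eq_arcExponent hI, C.restrict_extend]
    · rw [arcExponent, weight_one_sum_single,
        card_openers (nestFreeMatchings_subset_perfectMatchings hN)]

/-- **Carving, at fixed carving data.** For `q` with the support of `NN_n^R` and `I` disjoint from
`R`, the top-degree component of `q` carved along `I` has exactly the support of `NN_m` and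
complexity at most that of `q`. [folklore] -/
theorem exists_carved {R : Finset (Fin (2 * n))} (hR : ∀ i ∈ C.I, i ∉ R)
    (q : MvPolynomial (Fin (2 * n) × Fin (2 * n)) ℝ≥0)
    (hq : q.support = (MvPolynomial.aeval (fun e : Fin (2 * n) × Fin (2 * n) =>
        if e.1 ∈ R ∨ e.2 ∈ R then (1 : MvPolynomial (Fin (2 * n) × Fin (2 * n)) ℝ≥0)
        else MvPolynomial.X e) (nestFreeMatchingPoly n ℝ≥0)).support) :
    ∃ g : MvPolynomial (Fin (2 * C.m) × Fin (2 * C.m)) ℝ≥0,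
      g.support = (nestFreeMatchingPoly C.m ℝ≥0).support ∧ complexity g ≤ complexity q := by
  refine ⟨topComponent (fun _ => 1) (aeval C.subst q), ?_, ?_⟩
  · rw [support_topComponent_congr _ (support_aeval_congr C.subst hq), C.aeval_subst_aeval_free,
      support_topComponent_eq, C.support_aeval_substR hR, C.sup_weight_eq, C.filter_weight_eq,
      support_nestFreeMatchingPoly]
  · exact (complexity_topComponent_le _ _).trans
      (complexity_le_of_isProjection (C.isProjection_aeval_subst q))

end Carving

/-! ### Block pigeonhole and the degenerate case -/

/-- **Block pigeonhole.** `|R|+1` disjoint blocks `[2mk, 2mk+2m)`, `k ≤ |R|`: one misses `R`.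
[folklore] -/
theorem exists_free_block {N : ℕ} (R : Finset (Fin N)) {m : ℕ} (hm : 0 < m) :
    ∃ k, k ≤ R.card ∧ ∀ i ∈ R, ¬ (2 * m * k ≤ (i : ℕ) ∧ (i : ℕ) < 2 * m * k + 2 * m) := by
  have hlt : (R.image fun i : Fin N => (i : ℕ) / (2 * m)).card < (range (R.card + 1)).card := by
    rw [card_range]
    exact Nat.lt_succ_of_le card_image_le
  obtain ⟨k, hk, hk'⟩ := exists_mem_notMem_of_card_lt_card hlt
  refine ⟨k, Nat.le_of_lt_succ (mem_range.1 hk), fun i hi hb => hk' (mem_image.2 ⟨i, hi, ?_⟩)⟩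
  have h2m : 0 < 2 * m := by omega
  apply le_antisymm
  · exact Nat.le_of_lt_succ ((Nat.div_lt_iff_lt_mul h2m).2 (by linarith [hb.2]))
  · exact (Nat.le_div_iff_mul_le h2m).2 (by linarith [hb.1])

/-- `NN_0 = 1`: its support is `{0}` (the empty matching). [folklore] -/
theorem support_nestFreeMatchingPoly_zero :
    (nestFreeMatchingPoly 0 ℝ≥0).support = {0} := by
  rw [support_nestFreeMatchingPoly]
  have h0 : ∀ M : Fin (2 * 0) → Fin (2 * 0), arcExponent M = 0 := fun M => by
    have : openers M = ∅ := eq_empty_of_forall_notMem fun i _ => absurd i.2 (by omega)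
    rw [arcExponent, this, sum_empty]
  ext d
  rw [mem_image, mem_singleton]
  constructor
  · rintro ⟨M, -, rfl⟩
    exact h0 M
  · intro hd
    exact ⟨_, partner_mem_nestFreeMatchings 0, (h0 _).trans hd.symm⟩

end Carve

open Carve in
/-- **Stub S2 of line `freed_vertices` (crux `NNLowDegreeCofactorHard`, stmt-ValiantsHypothesis-22993),
verbatim: carving an interval.**  For every vertex set `R ⊆ [2n]` and every `q` with the support
of `NN_n^R` there are `n'` with `n ≤ (|R|+1)(n'+2)` and a polynomial `g` in the arc variables of
`[2n']` with EXACTLY the support of `NN_{n'}` and `L₊(g) ≤ L₊(q)`.  Proof: block pigeonhole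
(`exists_free_block`) + `Carve.Carving.exists_carved`; `n' = 0` when `n < |R|+1`. [folklore] -/
theorem stub_carveInterval :
    ∀ (n : ℕ) (R : Finset (Fin (2 * n))) (q : MvPolynomial (Fin (2 * n) × Fin (2 * n)) ℝ≥0),
      q.support = (MvPolynomial.aeval (fun e : Fin (2 * n) × Fin (2 * n) =>
          if e.1 ∈ R ∨ e.2 ∈ R then (1 : MvPolynomial (Fin (2 * n) × Fin (2 * n)) ℝ≥0)
          else MvPolynomial.X e) (nestFreeMatchingPoly n ℝ≥0)).support →
      ∃ n' : ℕ, n ≤ (R.card + 1) * (n' + 2) ∧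
        ∃ g : MvPolynomial (Fin (2 * n') × Fin (2 * n')) ℝ≥0,
          g.support = (nestFreeMatchingPoly n' ℝ≥0).support ∧ complexity g ≤ complexity q := by
  intro n R q hq
  obtain ⟨m, hm_eq⟩ : ∃ m, m = n / (R.card + 1) := ⟨_, rfl⟩
  have hmn : (R.card + 1) * m ≤ n := by rw [hm_eq]; exact Nat.mul_div_le n (R.card + 1)
  have hlt : n < (R.card + 1) * (m + 1) := by
    rw [hm_eq]; exact Nat.lt_mul_div_succ n (Nat.succ_pos R.card)
  have hbound : n ≤ (R.card + 1) * (m + 2) :=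
    hlt.le.trans (Nat.mul_le_mul_left _ (Nat.le_succ _))
  rcases Nat.eq_zero_or_pos m with hm | hm
  · refine ⟨0, hm ▸ hbound, 1, ?_, ?_⟩
    · rw [support_one, support_nestFreeMatchingPoly_zero]
    · rw [← C_1, complexity_C_holds]
      exact Nat.zero_le _
  · obtain ⟨k, hk, hfree⟩ := exists_free_block R hm
    have hmk : m * k + m ≤ n :=
      calc m * k + m ≤ m * R.card + m := Nat.add_le_add_right (Nat.mul_le_mul_left m hk) m
        _ = (R.card + 1) * m := by ring
        _ ≤ n := hmn
    have hle : 2 * m * k + 2 * m ≤ 2 * n :=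
      calc 2 * m * k + 2 * m = 2 * (m * k + m) := by ring
        _ ≤ 2 * n := by omega
    have heven : (2 * m * k) % 2 = 0 := by
      rw [Nat.mul_assoc]
      exact Nat.mul_mod_right 2 _
    let Cv : Carving n := ⟨2 * m * k, m, hle, hm, heven⟩
    have hR : ∀ i ∈ Cv.I, i ∉ R := fun i hi hiR => hfree i hiR (Cv.mem_I.1 hi)
    exact ⟨m, hbound, Cv.exists_carved hR q hq⟩

end Summit.ValiantsHypothesis.ValiantsHypothesis.Theorems.FifoMatching.NNLowDegreeCofactorHard.FreedVertices

end
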